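import Summits.CriticalPhenomena.PercolationContinuityZ3.Theorems.PercNearOneGluingNoHeavyLowerTailAntitheticCliqueApexZones
import Summits.CriticalPhenomena.PercolationContinuityZ3.Theorems.PercNearOneGluingNoHeavyLowerTailAntitheticZoneSystem
import HarnessLib

/-!
# `NoHeavyLowerTail` (stmt-CriticalPhenomena-4575) — antithetic cluster pairs: the zone system of THEOREM K (cones with clique-apexes,
# every avoidance set `R`) — part 1: definitions, colour swap, normal forms, apex and boundary (prim-hp-2 gen 37; MEMO-gen37 §1–§2)

Support file (`--supports stmt-CriticalPhenomena-4575`, hull-port prover `prim-hp-2`, gen 37).  No named facts, no sorries; standard axioms.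
The `def`s `Antithetic.ACone.{big, sw, hasRed, zone, beta}` are proof-internal bookkeeping of THEOREM K (`…AntitheticApexCone`).

CLASS ("cones with clique-apexes"): an edge set `E` on `V` with source `s` such that every vertex `x ≠ s` NOT adjacent to `s` has all its
`E`-neighbours adjacent to `s` and pairwise adjacent (`hN`, `hK` below; cones = no such `x`; THEOREM J's apex = one such `x`).
Colourings `T` (`T ∩ E` red, `Tᶜ ∩ E` blue); `r` is red-reached / blue-reached if `s` is joined to `r` in `T ∩ E` / `Tᶜ ∩ E`.

THE ZONE SYSTEM (rule v3 of MEMO-gen37 §1; census HOME/code/gen37/lab37/zonerule3.py, 0 failures on all 4 604 instances with n ≤ 5 and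
— kit j157250 — at n = 6).  For `r ∈ R` and `T` in the constraint set (no `r ∈ R` reached in both colours):
* `r` red-reached:  `zone = ` blue cluster of `r`, colour `beta = red`;   `r` blue-reached: red cluster, `beta = blue`;
* `r` unreached (then `r` is not adjacent to `s`, and by THEOREM J's key fact `Apex.mono_of_unreached` all edges at `r` have one colour
  `κ`): with `big r` = red cluster ∪ blue cluster of `r` (= the `κ`-cluster) and `sw r` ("swallowed") := some REACHED vertex of `R` lies in
  `big r`:  if `sw r` then `zone = big r`, `beta = ¬κ` (the zone and colour of the swallowing vertex), else `zone = {r}`, `beta = κ`.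
This file: swap lemmas (`T ↦ Tᶜ` fixes zones and flips colours), normal forms, `r ∈ zone`, `s ∉ zone`, and the BOUNDARY property (every edge
of `E` from outside a zone into it has the zone's colour).  Consistency, invariance and THEOREM K: `…ApexConeConsistency`,
`…ApexConeInvariance(Two)`, `…ApexCone`.
[cite: VandenbergHaggstromKahn2005, §1 p. 3 (open cluster `C_s`)]
-/

noncomputable section

namespace Summit.CriticalPhenomena.PercolationContinuityZ3.Theorems

open Literature.Probability.Percolation
open scoped Classical symmDiff

namespace Antithetic

/-! ## More cluster tools (general graphs) -/
section ClusterTools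

variable {V : Type*}

/-- Open clusters are classes: a vertex of the cluster of `x` has the same cluster. [folklore] -/
theorem openCluster_eq_of_mem (η : BondConfig V) {x y : V} (h : y ∈ openCluster η x) : openCluster η y = openCluster η x := by
  ext z
  constructor
  · exact fun hz => (show (openGraph η).Reachable x y from h).trans hz
  · exact fun hz => (show (openGraph η).Reachable x y from h).symm.trans hz

/-- A vertex `y ≠ x` of the cluster of `x` has an open non-loop pair into the cluster. [folklore] -/
theorem exists_adj_of_mem_openCluster (η : BondConfig V) {x y : V} (h : y ∈ openCluster η x) (hne : y ≠ x) :
    ∃ u, s(y, u) ∈ η ∧ u ≠ y ∧ u ∈ openCluster η x := by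
  obtain ⟨p⟩ := (show (openGraph η).Reachable x y from h).symm
  cases p with
  | nil => exact absurd rfl hne
  | @cons _ u _ hadj q =>
    rw [openGraph_adj] at hadj
    exact ⟨u, hadj.1, hadj.2.symm, q.reachable.symm⟩

/-- A vertex of the cluster of an unreached vertex is unreached. [folklore] -/
theorem not_reachable_of_mem_openCluster (η : BondConfig V) {s x y : V} (hy : y ∈ openCluster η x)
    (hx : ¬ (openGraph η).Reachable s x) : ¬ (openGraph η).Reachable s y :=
  fun h => hx (h.trans (show (openGraph η).Reachable x y from hy).symm)

/-- If every open pair at `x` is a loop then the cluster of `x` is `{x}`. [folklore] -/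
theorem openCluster_eq_singleton (η : BondConfig V) {x : V} (h : ∀ u, s(x, u) ∈ η → u = x) : openCluster η x = {x} := by
  ext y
  constructor
  · exact fun hy => Apex.eq_of_reachable_of_isolated h hy
  · rintro rfl
    exact mem_openCluster_self _ _

/-- A vertex adjacent to the source is reached in the colour of its spoke. [folklore] -/
theorem reached_of_spoke (E T : Set (Sym2 V)) {s v : V} (hsv : s(s, v) ∈ E) (hvs : v ≠ s) :
    (openGraph (T ∩ E)).Reachable s v ∨ (openGraph (Tᶜ ∩ E)).Reachable s v := by
  by_cases h : s(s, v) ∈ T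
  · exact Or.inl ((openGraph_adj (T ∩ E) s v).2 ⟨⟨h, hsv⟩, hvs.symm⟩).reachable
  · exact Or.inr ((openGraph_adj (Tᶜ ∩ E) s v).2 ⟨⟨h, hsv⟩, hvs.symm⟩).reachable

/-- The constraint "no vertex of `R` reached in both colours" is invariant under the colour swap. [this work] -/
theorem constraint_compl {E : Set (Sym2 V)} {s : V} {R : Set V} {T : Set (Sym2 V)}
    (hT : ∀ r ∈ R, ¬ ((openGraph (T ∩ E)).Reachable s r ∧ (openGraph (Tᶜ ∩ E)).Reachable s r)) :
    ∀ r ∈ R, ¬ ((openGraph (Tᶜ ∩ E)).Reachable s r ∧ (openGraph (Tᶜᶜ ∩ E)).Reachable s r) := by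
  intro r hr h
  rw [compl_compl] at h
  exact hT r hr ⟨h.2, h.1⟩

end ClusterTools

namespace ACone

variable {V : Type*}

/-- The two-colour star cluster of `r`: red cluster ∪ blue cluster. [this work] -/
def big (E T : Set (Sym2 V)) (r : V) : Set V := openCluster (T ∩ E) r ∪ openCluster (Tᶜ ∩ E) r

/-- The SWALLOWED vertices: `r` such that some vertex of `R` reached from `s` (in some colour) lies in the two-colour star cluster of
`r`. [this work] -/
def sw (E : Set (Sym2 V)) (s : V) (R : Set V) (T : Set (Sym2 V)) : Set V :=
  {r | ∃ q ∈ R, ((openGraph (T ∩ E)).Reachable s q ∨ (openGraph (Tᶜ ∩ E)).Reachable s q) ∧ q ∈ big E T r}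

/-- The vertices with a red non-loop edge. [this work] -/
def hasRed (E T : Set (Sym2 V)) : Set V := {r | ∃ u, s(r, u) ∈ E ∧ u ≠ r ∧ s(r, u) ∈ T}

/-- The ZONE of `r` (rule v3, module docstring). [this work] -/
def zone (E : Set (Sym2 V)) (s : V) (R : Set V) (T : Set (Sym2 V)) (r : V) : Set V :=
  {v | v = r ∨ ((openGraph (T ∩ E)).Reachable s r ∧ v ∈ openCluster (Tᶜ ∩ E) r) ∨
    ((openGraph (Tᶜ ∩ E)).Reachable s r ∧ v ∈ openCluster (T ∩ E) r) ∨
    (¬ (openGraph (T ∩ E)).Reachable s r ∧ ¬ (openGraph (Tᶜ ∩ E)).Reachable s r ∧ r ∈ sw E s R T ∧ v ∈ big E T r)}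

/-- The RED ZONES: the set of `r` whose zone has colour red (rule v3, module docstring); `r ∈ beta E s R T` is the colour `β_T(r)` of
the zone-system theorem. [this work] -/
def beta (E : Set (Sym2 V)) (s : V) (R : Set V) (T : Set (Sym2 V)) : Set V :=
  {r | (openGraph (T ∩ E)).Reachable s r ∨ (¬ (openGraph (Tᶜ ∩ E)).Reachable s r ∧ (r ∈ sw E s R T ↔ r ∉ hasRed E T))}

section Swap

variable (E : Set (Sym2 V)) (s : V) (R : Set V) (T : Set (Sym2 V)) (r : V)

/-- The star cluster is swap-invariant. [this work] -/
theorem big_compl : big E Tᶜ r = big E T r := by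
  rw [big, big, compl_compl, Set.union_comm]

/-- Swallowing is swap-invariant. [this work] -/
theorem sw_compl : r ∈ sw E s R Tᶜ ↔ r ∈ sw E s R T := by
  simp only [sw, Set.mem_setOf_eq, compl_compl, big_compl]
  exact exists_congr fun q => and_congr_right fun _ => and_congr_left fun _ => or_comm

/-- Zones are swap-invariant. [this work] -/
theorem zone_compl : zone E s R Tᶜ r = zone E s R T r := by
  ext v
  simp only [zone, Set.mem_setOf_eq, compl_compl, sw_compl, big_compl]
  tauto

variable {E T r}

/-- With a monochromatic non-empty star, `hasRed` flips under the swap. [this work] -/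
theorem hasRed_compl (hmono : (∀ u, s(r, u) ∈ E → u ≠ r → s(r, u) ∈ T) ∨ (∀ u, s(r, u) ∈ E → u ≠ r → s(r, u) ∉ T))
    (hedge : ∃ u, s(r, u) ∈ E ∧ u ≠ r) : r ∈ hasRed E Tᶜ ↔ r ∉ hasRed E T := by
  obtain ⟨u₀, hu₀E, hu₀⟩ := hedge
  constructor
  · rintro ⟨u, huE, hur, huT⟩ ⟨v, hvE, hvr, hvT⟩
    rcases hmono with h | h
    · exact huT (h u huE hur)
    · exact h v hvE hvr hvT
  · intro h
    rcases hmono with hm | hm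
    · exact absurd ⟨u₀, hu₀E, hu₀, hm u₀ hu₀E hu₀⟩ h
    · exact ⟨u₀, hu₀E, hu₀, hm u₀ hu₀E hu₀⟩

variable {s R}

/-- The zone colour flips under the swap (for `r` not doubly reached, with a monochromatic non-empty star if unreached). [this work] -/
theorem beta_compl (hD : ¬ ((openGraph (T ∩ E)).Reachable s r ∧ (openGraph (Tᶜ ∩ E)).Reachable s r))
    (hmono : ¬ (openGraph (T ∩ E)).Reachable s r → ¬ (openGraph (Tᶜ ∩ E)).Reachable s r →
      (∀ u, s(r, u) ∈ E → u ≠ r → s(r, u) ∈ T) ∨ (∀ u, s(r, u) ∈ E → u ≠ r → s(r, u) ∉ T))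
    (hedge : ∃ u, s(r, u) ∈ E ∧ u ≠ r) : r ∈ beta E s R Tᶜ ↔ r ∉ beta E s R T := by
  simp only [beta, Set.mem_setOf_eq, compl_compl, sw_compl]
  by_cases hr : (openGraph (T ∩ E)).Reachable s r
  · have hb : ¬ (openGraph (Tᶜ ∩ E)).Reachable s r := fun h => hD ⟨hr, h⟩
    simp only [hr, hb, not_true_eq_false, false_and, or_false, true_or, not_true_eq_false]
  · by_cases hb : (openGraph (Tᶜ ∩ E)).Reachable s r
    · simp only [hr, hb, not_false_eq_true, true_or, not_true_eq_false, false_and, or_self, not_false_eq_true]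
    · have h := hasRed_compl (hmono hr hb) hedge
      simp only [hr, hb, not_false_eq_true, true_and, false_or, h]
      tauto

end Swap

section NormalForms

variable {E : Set (Sym2 V)} {s : V} {R : Set V} {T : Set (Sym2 V)} {r : V}

/-- `r` lies in its zone. [this work] -/
theorem mem_zone_self : r ∈ zone E s R T r := Or.inl rfl

/-- Zone of a red-reached vertex. [this work] -/
theorem zone_of_red (hD : ¬ ((openGraph (T ∩ E)).Reachable s r ∧ (openGraph (Tᶜ ∩ E)).Reachable s r))
    (hr : (openGraph (T ∩ E)).Reachable s r) : zone E s R T r = openCluster (Tᶜ ∩ E) r := by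
  have hb : ¬ (openGraph (Tᶜ ∩ E)).Reachable s r := fun h => hD ⟨hr, h⟩
  ext v
  constructor
  · rintro (rfl | ⟨-, h⟩ | ⟨h, -⟩ | ⟨h, -⟩)
    · exact mem_openCluster_self _ _
    · exact h
    · exact absurd h hb
    · exact absurd hr h
  · exact fun h => Or.inr (Or.inl ⟨hr, h⟩)

/-- Zone of a blue-reached vertex. [this work] -/
theorem zone_of_blue (hD : ¬ ((openGraph (T ∩ E)).Reachable s r ∧ (openGraph (Tᶜ ∩ E)).Reachable s r))
    (hb : (openGraph (Tᶜ ∩ E)).Reachable s r) : zone E s R T r = openCluster (T ∩ E) r := by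
  rw [← zone_compl]
  have := zone_of_red (E := E) (R := R) (T := Tᶜ) (r := r) (s := s) (by rw [compl_compl]; exact fun h => hD ⟨h.2, h.1⟩) hb
  rw [compl_compl] at this
  exact this

/-- Zone of a swallowed unreached vertex. [this work] -/
theorem zone_of_sw (hr : ¬ (openGraph (T ∩ E)).Reachable s r) (hb : ¬ (openGraph (Tᶜ ∩ E)).Reachable s r)
    (hsw : r ∈ sw E s R T) : zone E s R T r = big E T r := by
  ext v
  constructor
  · rintro (rfl | ⟨h, -⟩ | ⟨h, -⟩ | ⟨-, -, -, h⟩)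
    · exact Or.inl (mem_openCluster_self _ _)
    · exact absurd h hr
    · exact absurd h hb
    · exact h
  · exact fun h => Or.inr (Or.inr (Or.inr ⟨hr, hb, hsw, h⟩))

/-- Zone of a non-swallowed unreached vertex. [this work] -/
theorem zone_of_small (hr : ¬ (openGraph (T ∩ E)).Reachable s r) (hb : ¬ (openGraph (Tᶜ ∩ E)).Reachable s r)
    (hsw : r ∉ sw E s R T) : zone E s R T r = {r} := by
  ext v
  constructor
  · rintro (h | ⟨h, -⟩ | ⟨h, -⟩ | ⟨-, -, h, -⟩)
    · exact h
    · exact absurd h hr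
    · exact absurd h hb
    · exact absurd h hsw
  · exact fun h => Or.inl h

/-- Colour of a red-reached vertex. [this work] -/
theorem beta_of_red (hr : (openGraph (T ∩ E)).Reachable s r) : r ∈ beta E s R T := Or.inl hr

/-- Colour of a blue-reached vertex. [this work] -/
theorem not_beta_of_blue (hD : ¬ ((openGraph (T ∩ E)).Reachable s r ∧ (openGraph (Tᶜ ∩ E)).Reachable s r))
    (hb : (openGraph (Tᶜ ∩ E)).Reachable s r) : r ∉ beta E s R T := by
  rintro (h | ⟨h, -⟩)
  · exact hD ⟨h, hb⟩
  · exact h hb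

/-- Colour of an unreached vertex. [this work] -/
theorem beta_iff_of_none (hr : ¬ (openGraph (T ∩ E)).Reachable s r) (hb : ¬ (openGraph (Tᶜ ∩ E)).Reachable s r) :
    r ∈ beta E s R T ↔ (r ∈ sw E s R T ↔ r ∉ hasRed E T) := by
  simp only [beta, Set.mem_setOf_eq, hr, hb, false_or, not_false_eq_true, true_and]

/-- Star cluster of a vertex with only red edges: the red cluster. [this work] -/
theorem big_of_allRed (h : ∀ u, s(r, u) ∈ E → u ≠ r → s(r, u) ∈ T) : big E T r = openCluster (T ∩ E) r := by
  have hb : openCluster (Tᶜ ∩ E) r = {r} := openCluster_eq_singleton _ fun u hu => by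
    by_contra hur
    exact hu.1 (h u hu.2 hur)
  rw [big, hb, Set.union_eq_left]
  rintro v rfl
  exact mem_openCluster_self _ _

/-- Star cluster of a vertex with only blue edges: the blue cluster. [this work] -/
theorem big_of_allBlue (h : ∀ u, s(r, u) ∈ E → u ≠ r → s(r, u) ∉ T) : big E T r = openCluster (Tᶜ ∩ E) r := by
  rw [← big_compl]
  exact big_of_allRed (T := Tᶜ) fun u hu hur => h u hu hur

/-- An unreached vertex differs from the source. [folklore] -/
theorem ne_source_of_unreached (hr : ¬ (openGraph (T ∩ E)).Reachable s r) : r ≠ s := by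
  rintro rfl
  exact hr (SimpleGraph.Reachable.refl _)

/-- An unreached vertex is not adjacent to the source. [folklore] -/
theorem spokeless_of_unreached (hr : ¬ (openGraph (T ∩ E)).Reachable s r) (hb : ¬ (openGraph (Tᶜ ∩ E)).Reachable s r) :
    s(s, r) ∉ E := fun h =>
  (reached_of_spoke E T h (ne_source_of_unreached hr)).elim hr hb

/-- **Key fact of THEOREM J in class form**: in the class, an unreached vertex has a monochromatic star. [this work] -/
theorem mono_of_unreached (hN : ∀ x u, x ≠ s → s(s, x) ∉ E → s(x, u) ∈ E → u ≠ x → s(s, u) ∈ E)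
    (hK : ∀ x u v, x ≠ s → s(s, x) ∉ E → s(x, u) ∈ E → s(x, v) ∈ E → u ≠ x → v ≠ x → u ≠ v → s(u, v) ∈ E)
    (hr : ¬ (openGraph (T ∩ E)).Reachable s r) (hb : ¬ (openGraph (Tᶜ ∩ E)).Reachable s r) :
    (∀ u, s(r, u) ∈ E → u ≠ r → s(r, u) ∈ T) ∨ (∀ u, s(r, u) ∈ E → u ≠ r → s(r, u) ∉ T) :=
  have hsr := spokeless_of_unreached hr hb
  have hrs := ne_source_of_unreached hr
  Apex.mono_of_unreached hrs (fun u => hN r u hrs hsr) (fun u v => hK r u v hrs hsr) hr hb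

/-- A swallowed unreached vertex has a non-loop edge, and its swallower differs from it. [this work] -/
theorem sw_witness (hr : ¬ (openGraph (T ∩ E)).Reachable s r) (hb : ¬ (openGraph (Tᶜ ∩ E)).Reachable s r)
    (hsw : r ∈ sw E s R T) :
    ∃ q ∈ R, ((openGraph (T ∩ E)).Reachable s q ∨ (openGraph (Tᶜ ∩ E)).Reachable s q) ∧ q ∈ big E T r ∧ q ≠ r := by
  obtain ⟨q, hqR, hq, hqb⟩ := hsw
  refine ⟨q, hqR, hq, hqb, ?_⟩
  rintro rfl
  exact hq.elim hr hb

/-- A vertex `q ≠ r` in the star cluster of `r` forces a non-loop edge at `r` of the corresponding colour. [this work] -/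
theorem edge_of_mem_big {q : V} (hq : q ∈ big E T r) (hne : q ≠ r) :
    (∃ u, s(r, u) ∈ E ∧ u ≠ r ∧ s(r, u) ∈ T ∧ q ∈ openCluster (T ∩ E) r) ∨
      (∃ u, s(r, u) ∈ E ∧ u ≠ r ∧ s(r, u) ∉ T ∧ q ∈ openCluster (Tᶜ ∩ E) r) := by
  rcases hq with h | h
  · obtain ⟨u, hu, hur⟩ := Apex.exists_adj_of_reachable (η := T ∩ E) hne.symm
      (show (openGraph (T ∩ E)).Reachable q r from (show (openGraph (T ∩ E)).Reachable r q from h).symm)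
    exact Or.inl ⟨u, hu.2, hur, hu.1, h⟩
  · obtain ⟨u, hu, hur⟩ := Apex.exists_adj_of_reachable (η := Tᶜ ∩ E) hne.symm
      (show (openGraph (Tᶜ ∩ E)).Reachable q r from (show (openGraph (Tᶜ ∩ E)).Reachable r q from h).symm)
    exact Or.inr ⟨u, hu.2, hur, hu.1, h⟩

/-- A vertex that is not doubly reached differs from the source. [folklore] -/
theorem ne_source_of_constraint (hD : ¬ ((openGraph (T ∩ E)).Reachable s r ∧ (openGraph (Tᶜ ∩ E)).Reachable s r)) : r ≠ s := by
  rintro rfl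
  exact hD ⟨SimpleGraph.Reachable.refl _, SimpleGraph.Reachable.refl _⟩

/-- The source lies in no zone (of a vertex that is not doubly reached). [this work] -/
theorem source_not_mem_zone (hD : ¬ ((openGraph (T ∩ E)).Reachable s r ∧ (openGraph (Tᶜ ∩ E)).Reachable s r)) :
    s ∉ zone E s R T r := by
  have hrs := ne_source_of_constraint hD
  rintro (h | ⟨hr, h⟩ | ⟨hb, h⟩ | ⟨hr, hb, -, h⟩)
  · exact hrs h.symm
  · exact hD ⟨hr, (show (openGraph (Tᶜ ∩ E)).Reachable r s from h).symm⟩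
  · exact hD ⟨(show (openGraph (T ∩ E)).Reachable r s from h).symm, hb⟩
  · rcases h with h | h
    · exact hr (show (openGraph (T ∩ E)).Reachable r s from h).symm
    · exact hb (show (openGraph (Tᶜ ∩ E)).Reachable r s from h).symm

/-- **Boundary property**: every edge of `E` from outside the zone of `r` into it has the zone's colour. [this work] -/
theorem boundary (hN : ∀ x u, x ≠ s → s(s, x) ∉ E → s(x, u) ∈ E → u ≠ x → s(s, u) ∈ E)
    (hK : ∀ x u v, x ≠ s → s(s, x) ∉ E → s(x, u) ∈ E → s(x, v) ∈ E → u ≠ x → v ≠ x → u ≠ v → s(u, v) ∈ E)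
    (hD : ¬ ((openGraph (T ∩ E)).Reachable s r ∧ (openGraph (Tᶜ ∩ E)).Reachable s r))
    {x y : V} (hx : x ∉ zone E s R T r) (hy : y ∈ zone E s R T r) (hxy : s(x, y) ∈ E) :
    (s(x, y) ∈ T ↔ r ∈ beta E s R T) := by
  by_cases hr : (openGraph (T ∩ E)).Reachable s r
  · rw [zone_of_red hD hr] at hx hy
    have h := not_mem_of_boundary (Tᶜ ∩ E) r hx hy
    exact iff_of_true (by_contra fun h' => h ⟨h', hxy⟩) (beta_of_red hr)
  · by_cases hb : (openGraph (Tᶜ ∩ E)).Reachable s r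
    · rw [zone_of_blue hD hb] at hx hy
      have h := not_mem_of_boundary (T ∩ E) r hx hy
      exact iff_of_false (fun h' => h ⟨h', hxy⟩) (not_beta_of_blue hD hb)
    · rw [beta_iff_of_none hr hb]
      rcases mono_of_unreached hN hK hr hb with hm | hm
      · have hred : ∀ u, s(r, u) ∈ E → u ≠ r → r ∈ hasRed E T := fun u hu hur => ⟨u, hu, hur, hm u hu hur⟩
        by_cases hsw : r ∈ sw E s R T
        · rw [zone_of_sw hr hb hsw, big_of_allRed hm] at hx hy
          have h := not_mem_of_boundary (T ∩ E) r hx hy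
          obtain ⟨q, -, -, hqb, hqr⟩ := sw_witness hr hb hsw
          have hred' : r ∈ hasRed E T := by
            rcases edge_of_mem_big hqb hqr with ⟨u, huE, hur, -, -⟩ | ⟨u, huE, hur, -, -⟩
            · exact hred u huE hur
            · exact hred u huE hur
          exact iff_of_false (fun h' => h ⟨h', hxy⟩) fun h' => (h'.1 hsw) hred'
        · rw [zone_of_small hr hb hsw, Set.mem_singleton_iff] at hx hy
          subst hy
          have hyx : s(y, x) ∈ E := by rw [Sym2.eq_swap]; exact hxy
          refine iff_of_true (by rw [Sym2.eq_swap]; exact hm x hyx hx) ?_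
          exact (iff_false_left hsw).2 (not_not.2 (hred x hyx hx))
      · have hnred : r ∉ hasRed E T := fun ⟨u, huE, hur, huT⟩ => hm u huE hur huT
        by_cases hsw : r ∈ sw E s R T
        · rw [zone_of_sw hr hb hsw, big_of_allBlue hm] at hx hy
          have h := not_mem_of_boundary (Tᶜ ∩ E) r hx hy
          exact iff_of_true (by_contra fun h' => h ⟨h', hxy⟩) ((iff_true_left hsw).2 hnred)
        · rw [zone_of_small hr hb hsw, Set.mem_singleton_iff] at hx hy
          subst hy
          have hyx : s(y, x) ∈ E := by rw [Sym2.eq_swap]; exact hxy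
          refine iff_of_false (by rw [Sym2.eq_swap]; exact hm x hyx hx) ?_
          exact fun h' => hsw (h'.2 hnred)

end NormalForms

end ACone

end Antithetic

end Summit.CriticalPhenomena.PercolationContinuityZ3.Theorems
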